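import Literature.AlgebraicGeometry.Frobenioids.PermutationOfPrimes
import Literature.AlgebraicGeometry.Frobenioids.ElementaryFrobeniusCompact
import Literature.AlgebraicGeometry.Frobenioids.ArithmeticFrobenioidIsotropic
import HarnessLib

/-!
# Frobenioids I, Example 3.8 (permutation of primes): the Frobenioid-level claims PROVED

Mochizuki, *The geometry of Frobenioids I: the general theory*, Kyushu J. Math. **62** (2008)
293–400, kurims text p. 71 [cite: MochizukiFrdI2008, Ex. 3.8 p.71]. PROOF-ONLY companion of
`PermutationOfPrimes.lean` (seat abc-iut-L1-t8; data `P : Ex38.Datum` = the involution `α` of `N_{≥1}`,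
`G = ℚ ⋊ N`, `D = B(G)`, `Φ = V × W = ℚ × ℚ` with `g ↦ (α(n), α(n) · n⁻¹)`, `C := F_Φ`), whose module
docstring deferred the claims below until [FrdI] Def. 1.2/1.3/3.1 landed. "`C`" is the elementary
Frobenioid `F_Φ → F_{Φ^char}` (found's `ElemFrobenioid.toChar`).

PROVED (p. 71): `Φ` is a monoid on `D` (its pull-backs are bijective); "`C` is a Frobenioid of
Frobenius-normalized, isotropic, and group-like type [cf. Proposition 1.5, (i), (iii)]"
(`Ex38.isFrobenioid`, `…isOfType_isFrobeniusNormalized`, `…isOfIsotropicType`, `…isOfType_isGroupLikeObj`);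
"Since the unique object of `C` has '`O^×(−)`' equal to `V × W`, it follows from our definition of `Φ` that
this object is Frobenius-compact" (`Ex38.isFrobeniusCompact`: if `g ∈ G` over `n ∈ N` acts on
`(V × W)^pf = ℚ × ℚ` by a scalar `p/q`, then `α(n) = p/q = α(n) n⁻¹`, so `n = 1` and `g` acts trivially);
"Thus, `C` is of standard type" (`Ex38.isOfStandardType`; (d) = `Ex38.isOfFSMFFType_D`, (e): `Φ^char = 0`).
Already landed: "`D` fails to be Frobenius-slim" (`RatSemidirect.not_isFrobeniusSlim_D`, `DivSlimExampleProofs.lean`),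
"`Aut(D_A → D) ≅ G`" (`OneObjectAutForget.lean`), the automorphism of the printed monoid `M` and what it
fails to preserve (`PermutationOfPrimes.lean`).
No statement of the paper is strengthened; nothing here takes a side on [IUTchIII] Cor. 3.12.
-/

namespace Literature.AlgebraicGeometry.Frobenioids

open CategoryTheory Opposite

/-! ### Two general one-object facts -/

/-- A contravariant action of a group (`act (g g') = act g' ∘ act g`, `act 1 = id`) acts by bijections.
[cite: MochizukiFrdI2008, Def. 1.1 (ii) p.19] -/
theorem bijective_of_contravariant_action {G : Type*} [Group G] {M : Type*} (act : G → M → M)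
    (hmul : ∀ g g' x, act (g * g') x = act g' (act g x)) (hone : ∀ x, act 1 x = x) (g : G) :
    Function.Bijective (act g) :=
  Function.bijective_iff_has_inverse.mpr
    ⟨act g⁻¹, fun x => by rw [← hmul, mul_inv_cancel, hone], fun x => by rw [← hmul, inv_mul_cancel, hone]⟩

/-- The one-object category of a group is totally epimorphic (a groupoid). [cite: MochizukiFrdI2008, §0 p.14] -/
theorem isTotallyEpimorphic_singleObj_group (G : Type) [Group G] : IsTotallyEpimorphic (SingleObj G) :=
  ⟨fun _ => inferInstance⟩

namespace Ex38

open RatSemidirect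

variable (P : Datum)

/-- The pull-back maps of `Φ` are the actions `act g`. [cite: MochizukiFrdI2008, Ex. 3.8 p.71] -/
theorem pull_Φ {X Y : D} (f : Y ⟶ X) (x : Multiplicative (ℚ × ℚ)) :
    pull (Literature.AlgebraicGeometry.Frobenioids.Ex38.Φ P) f x = P.act (show G from f) x := rfl

/-- The actions `act g` are bijective (inverse `act g⁻¹`). [cite: MochizukiFrdI2008, Ex. 3.8 p.71] -/
theorem act_bijective (g : G) : Function.Bijective (P.act g) :=
  bijective_of_contravariant_action (fun g x => P.act g x)
    (fun g g' x => by rw [Datum.act_mul]; rfl) (fun x => by rw [Datum.act_one]; rfl) g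

/-- **Example 3.8**: `Φ` "[manifestly non-dilating] monoid on `D`" — `Φ` is a monoid on `D` in the sense of
Def. 1.1 (ii) (all pull-backs are bijective). [cite: MochizukiFrdI2008, Ex. 3.8 p.71] -/
theorem isMonoidOn_Φ : IsMonoidOn (Literature.AlgebraicGeometry.Frobenioids.Ex38.Φ P) :=
  isMonoidOn_of_bijective fun f => act_bijective P (show G from f)

/-- `Φ ≡ V × W = ℚ × ℚ` is (objectwise) group-like. [cite: MochizukiFrdI2008, Ex. 3.8 p.71] -/
theorem objectwise_isGroupLike_Φ :
    Objectwise (fun N _ => IsGroupLike N) (Literature.AlgebraicGeometry.Frobenioids.Ex38.Φ P) :=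
  fun _ => isGroupLike_of_commGroup (Multiplicative (ℚ × ℚ))

/-- **Example 3.8**: "`C := F_Φ`. Thus, `C` is a Frobenioid" — `F_Φ → F_{Φ^char}` is a Frobenioid (Prop. 1.5 (i),
over the connected, totally epimorphic `D = B(G)`). [cite: MochizukiFrdI2008, Ex. 3.8 p.71] -/
theorem isFrobenioid :
    PreFrobenioid.IsFrobenioid (ElemFrobenioid.toChar (Literature.AlgebraicGeometry.Frobenioids.Ex38.Φ P)) :=
  ElemFrobenioid.isFrobenioid_toChar (isMonoidOn_Φ P) (fun X => (objectwise_isGroupLike_Φ P X).isPreDivisorial)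
    (isGraphConnected_singleObj G) (isTotallyEpimorphic_singleObj_group G)

/-- **Example 3.8**: "… of Frobenius-normalized … type" (Prop. 1.5 (i)). [cite: MochizukiFrdI2008, Ex. 3.8 p.71] -/
theorem isOfType_isFrobeniusNormalized :
    PreFrobenioid.IsOfType (PreFrobenioid.IsFrobeniusNormalized
      (ElemFrobenioid.toChar (Literature.AlgebraicGeometry.Frobenioids.Ex38.Φ P))) :=
  fun A => ElemFrobenioid.isFrobeniusNormalized A

/-- **Example 3.8**: "… isotropic … type" (Prop. 1.5 (i)). [cite: MochizukiFrdI2008, Ex. 3.8 p.71] -/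
theorem isOfIsotropicType :
    PreFrobenioid.IsOfIsotropicType (ElemFrobenioid.toChar (Literature.AlgebraicGeometry.Frobenioids.Ex38.Φ P)) :=
  fun A => ElemFrobenioid.isIsotropic A

/-- **Example 3.8**: "… and group-like type [cf. Proposition 1.5, (i), (iii)]". [cite: MochizukiFrdI2008, Ex. 3.8 p.71] -/
theorem isOfType_isGroupLikeObj :
    PreFrobenioid.IsOfType (PreFrobenioid.IsGroupLikeObj
      (ElemFrobenioid.toChar (Literature.AlgebraicGeometry.Frobenioids.Ex38.Φ P))) :=
  ElemFrobenioid.isOfType_isGroupLikeObj (objectwise_isGroupLike_Φ P)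

/-! ### Frobenius-compactness of the unique object -/

/-- If `g ∈ G` acts on `(V × W)^pf = ℚ × ℚ` through a unit `c = (x, y)` with `((g^* c)^q)^N = (c^p)^N` (`N ≥ 1`), then
`q · α(n) · x = p · x` and `q · α(n) n⁻¹ · y = p · y` (`n` the `N`-coordinate of `g`).
[cite: MochizukiFrdI2008, Ex. 3.8 p.71] -/
theorem scalar_eqs_of_pow_eq {g : G} {p q : ℕ+} {N : ℕ} (hN : 0 < N) (c : (Multiplicative (ℚ × ℚ))ˣ)
    (h : ((Units.map (P.act g) c) ^ (q : ℕ)) ^ N = (c ^ (p : ℕ)) ^ N) :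
    (q : ℚ) * (P.cV g.n * (Multiplicative.toAdd (c : Multiplicative (ℚ × ℚ))).1) =
        (p : ℚ) * (Multiplicative.toAdd (c : Multiplicative (ℚ × ℚ))).1 ∧
      (q : ℚ) * (P.cW g.n * (Multiplicative.toAdd (c : Multiplicative (ℚ × ℚ))).2) =
        (p : ℚ) * (Multiplicative.toAdd (c : Multiplicative (ℚ × ℚ))).2 := by
  have hN' : (N : ℚ) ≠ 0 := by exact_mod_cast hN.ne'
  have h1 := congrArg (fun u : (Multiplicative (ℚ × ℚ))ˣ => (Multiplicative.toAdd (u : Multiplicative (ℚ × ℚ))).1) h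
  have h2 := congrArg (fun u : (Multiplicative (ℚ × ℚ))ˣ => (Multiplicative.toAdd (u : Multiplicative (ℚ × ℚ))).2) h
  simp only [Units.val_pow_eq_pow_val, Units.coe_map, toAdd_pow, Prod.smul_fst, Prod.smul_snd,
    Datum.toAdd_act] at h1 h2
  simp only [nsmul_eq_mul] at h1 h2
  exact ⟨mul_left_cancel₀ hN' (by linarith), mul_left_cancel₀ hN' (by linarith)⟩

/-- Testing on `(1, 0) ∈ V × W`: the scalar of `g` on `V` is `p/q`. [cite: MochizukiFrdI2008, Ex. 3.8 p.71] -/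
theorem cV_eq_of_pow_eq {g : G} {p q : ℕ+} {N : ℕ} (hN : 0 < N)
    (h : ((Units.map (P.act g) (toUnits (Multiplicative.ofAdd ((1 : ℚ), (0 : ℚ))))) ^ (q : ℕ)) ^ N =
      ((toUnits (Multiplicative.ofAdd ((1 : ℚ), (0 : ℚ)))) ^ (p : ℕ)) ^ N) :
    (q : ℚ) * P.cV g.n = p := by
  have e := (scalar_eqs_of_pow_eq P hN _ h).1
  simp only [val_toUnits_apply, toAdd_ofAdd, mul_one] at e
  exact e

/-- Testing on `(0, 1) ∈ V × W`: the scalar of `g` on `W` is `p/q`. [cite: MochizukiFrdI2008, Ex. 3.8 p.71] -/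
theorem cW_eq_of_pow_eq {g : G} {p q : ℕ+} {N : ℕ} (hN : 0 < N)
    (h : ((Units.map (P.act g) (toUnits (Multiplicative.ofAdd ((0 : ℚ), (1 : ℚ))))) ^ (q : ℕ)) ^ N =
      ((toUnits (Multiplicative.ofAdd ((0 : ℚ), (1 : ℚ)))) ^ (p : ℕ)) ^ N) :
    (q : ℚ) * P.cW g.n = p := by
  have e := (scalar_eqs_of_pow_eq P hN _ h).2
  simp only [val_toUnits_apply, toAdd_ofAdd, mul_one] at e
  exact e

/-- `(1, 0) ∈ V × W = ℚ × ℚ` has infinite order ("`O^×(−)^pf ≠ 0`"). [cite: MochizukiFrdI2008, Ex. 3.8 p.71] -/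
theorem toUnits_one_zero_pow_ne_one {N : ℕ} (hN : 0 < N) :
    (toUnits (Multiplicative.ofAdd ((1 : ℚ), (0 : ℚ)))) ^ N ≠ 1 := by
  intro h
  have h1 := congrArg (fun u : (Multiplicative (ℚ × ℚ))ˣ => (Multiplicative.toAdd (u : Multiplicative (ℚ × ℚ))).1) h
  simp only [Units.val_pow_eq_pow_val, val_toUnits_apply, toAdd_pow, toAdd_ofAdd, Prod.smul_fst, Units.val_one,
    toAdd_one, Prod.fst_zero] at h1
  simp only [nsmul_eq_mul, mul_one, Nat.cast_eq_zero] at h1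
  omega

/-- `α(n) = α(n) · n⁻¹` forces `n = 1`. [cite: MochizukiFrdI2008, Ex. 3.8 p.71] -/
theorem n_eq_one_of_cV_eq_cW {n : N} (h : P.cV n = P.cW n) : n = 1 := by
  unfold Datum.cV Datum.cW at h
  have hα : ((P.αN n : N) : ℚ) ≠ 0 := ne_of_gt (P.αN n).2
  have hn : (n : ℚ) ≠ 0 := ne_of_gt n.2
  have h2 : ((P.αN n : N) : ℚ) * (n : ℚ) = (P.αN n : N) := (eq_mul_inv_iff_mul_eq₀ hn).mp h
  have h3 : (n : ℚ) = 1 := mul_left_cancel₀ hα (h2.trans (mul_one _).symm)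
  exact Subtype.ext h3

/-- An element of `G` with trivial `N`-coordinate acts trivially on `V × W` (`α(1) = 1`).
[cite: MochizukiFrdI2008, Ex. 3.8 p.71] -/
theorem act_eq_id_of_n_eq_one {g : G} (hg : g.n = 1) : P.act g = MonoidHom.id _ := by
  refine MonoidHom.ext fun z => Multiplicative.toAdd.injective ?_
  simp [Datum.toAdd_act, hg]

/-- **Example 3.8**: "Since the unique object of `C` has '`O^×(−)`' equal to `V × W`, it follows from our
definition of `Φ` that this object is Frobenius-compact" (FrdI p. 71) — PROVED for the unique object of
`F_Φ → F_{Φ^char}`: `O^× ≅ ℚ × ℚ` has elements of infinite order, and if `g` (over `n ∈ N`) acts on it by a scalar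
`p/q` then, testing on `(1, 0)` and `(0, 1)`, `α(n) = p/q = α(n) n⁻¹`, so `n = 1` and `g` acts trivially.
[cite: MochizukiFrdI2008, Ex. 3.8 p.71] -/
theorem isFrobeniusCompact :
    (PreFrobenioidData.ofFunctor (charFunctor (Literature.AlgebraicGeometry.Frobenioids.Ex38.Φ P))
      (ElemFrobenioid.toChar (Literature.AlgebraicGeometry.Frobenioids.Ex38.Φ P))).IsFrobeniusCompact
      (Literature.AlgebraicGeometry.Frobenioids.Ex38.obj P) := by
  refine ElemFrobenioid.isFrobeniusCompact_of _
    ⟨toUnits (Multiplicative.ofAdd ((1 : ℚ), (0 : ℚ))), fun N hN h => toUnits_one_zero_pow_ne_one hN h⟩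
    fun β p q _ hyp c => ⟨1, Nat.one_pos, ?_⟩
  -- the scalar of `β = g` on `V`, resp. `W`, is `p/q`: test on `(1,0)` and `(0,1)`
  obtain ⟨N₁, hN₁, h₁⟩ := hyp (toUnits (Multiplicative.ofAdd ((1 : ℚ), (0 : ℚ))))
  obtain ⟨N₂, hN₂, h₂⟩ := hyp (toUnits (Multiplicative.ofAdd ((0 : ℚ), (1 : ℚ))))
  have e₁ : (q : ℚ) * P.cV (show G from β).n = p := cV_eq_of_pow_eq P hN₁ h₁
  have e₂ : (q : ℚ) * P.cW (show G from β).n = p := cW_eq_of_pow_eq P hN₂ h₂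
  have hq : (q : ℚ) ≠ 0 := by exact_mod_cast q.ne_zero
  have hVW : P.cV (show G from β).n = P.cW (show G from β).n := mul_left_cancel₀ hq (e₁.trans e₂.symm)
  have hn : (show G from β).n = 1 := n_eq_one_of_cV_eq_cW P hVW
  rw [pow_one, pow_one]
  refine Units.ext ?_
  rw [Units.coe_map]
  show P.act (show G from β) _ = _
  rw [act_eq_id_of_n_eq_one P hn, MonoidHom.id_apply]

/-- **Example 3.8**: "Thus, `C` is of standard type" (FrdI p. 71; Def. 3.1 (i): (a), (c) by Prop. 1.5 (i); (b) the
Frobenius-compact unique object; (d) "`D` is manifestly of FSM-, hence also of FSMFF-type" (`isOfFSMFFType_D`); (e)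
`Φ^char = 0` is non-dilating) — PROVED for `F_Φ → F_{Φ^char}`. [cite: MochizukiFrdI2008, Ex. 3.8 p.71] -/
theorem isOfStandardType :
    (PreFrobenioidData.ofFunctor (charFunctor (Literature.AlgebraicGeometry.Frobenioids.Ex38.Φ P))
      (ElemFrobenioid.toChar (Literature.AlgebraicGeometry.Frobenioids.Ex38.Φ P))).IsOfStandardType := by
  haveI : Subsingleton (Associates (Multiplicative (ℚ × ℚ))) :=
    (isGroupLike_of_commGroup (Multiplicative (ℚ × ℚ))).subsingleton_associates
  refine ElemFrobenioid.isOfStandardType_toChar_of (isMonoidOn_Φ P)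
    (fun X => (objectwise_isGroupLike_Φ P X).isPreDivisorial) (isGraphConnected_singleObj G)
    (isTotallyEpimorphic_singleObj_group G) (fun _ => ⟨_, isFrobeniusCompact P⟩) isOfFSMFFType_D ⟨fun X f _ a => ?_⟩
  have : Subsingleton (Associates ((PreFrobenioidData.ofFunctor
      (charFunctor (Literature.AlgebraicGeometry.Frobenioids.Ex38.Φ P))
      (ElemFrobenioid.toChar (Literature.AlgebraicGeometry.Frobenioids.Ex38.Φ P))).Mon X)) := by
    change Subsingleton (Associates (Associates (Multiplicative (ℚ × ℚ))))
    infer_instance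
  exact Subsingleton.elim _ _

end Ex38

end Literature.AlgebraicGeometry.Frobenioids
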